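import Literature.Barriers.QuantumAdvantage.BoundedEntanglementIntegral
import Literature.Barriers.QuantumAdvantage.BoundedEntanglementBlocks
import HarnessLib

/-!
# The update rules of the `p`-blocked simulation in exact `ℤ[ω]` arithmetic

Topic `Literature/Barriers/QuantumAdvantage`; sixth file of the proof programme for the named
fact `Literature.Barriers.QuantumAdvantage.jozsaLinden2003_pblocked` (Jozsa–Linden 2003, §3). The
classical machine of lemma `ratpbl` stores, for every block `B` of the current block partition
(`BoundedEntanglementBlocks.blocksAfter`), the integral Gram data `gramZ B (ampZ F x j)`
(`BoundedEntanglementIntegral.lean`; Jozsa–Linden's "(b) block states", here canonical reduced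
states times `2^h`) and updates them by integer arithmetic on coordinates. This file states and
proves, at the level of `ZW`-coordinates and for the actual data of a Clifford+`T` family, the
identities that this arithmetic implements — each is the corresponding `ℂ`-identity of
`BoundedEntanglementGram.lean` pulled back along the injective evaluation `ZW.zwVal`:

* scalars do not matter: `Splits.smul`, `splits_smul_iff`, `atom_smul`, `gram_smul`, hence
  `splits_ampZ_iff`, `atom_ampZ` (the rescaled integral state has the blocks of the state);
* **merge** `gramZ_union_ampZ`: `gramZ (B₁ ∪ B₂) = divPow h (gramZ B₁ ⋆ gramZ B₂)` for a
  splitting `B₁` and a disjoint `B₂` (exact division by `2^h = ‖√2^h α_j‖²`);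
* **gate inside** `gramZ_ampZ_succ_of_subset`: `gramZ C` after gate `j` (wires inside `C`) is
  `V · gramZ C · V†` with the rescaled integer gate `V = gateZ op`;
* **gate outside** `gramZ_ampZ_succ_of_disjoint`: a block avoiding the gate has its data
  multiplied by `2^{qScale}` (doubled for a Hadamard gate, unchanged otherwise);
* **partial trace** `gramZ_eq_sum_gramZ`;
* **split test** `exists_gramZ_self_ne_zero`, `splits_stateAfter_iff_columnZ`: inside a
  splitting `C`, with a column index `y₀` of nonzero diagonal entry, `S ⊆ C` splits the state iff
  the products of column entries agree coordinatewise — and `mem_atom_stateAfter_succ_iff`: the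
  new blocks inside `C` are cut out by these tests.

## References

* R. Jozsa, N. Linden, *On the role of entanglement in quantum-computational speed-up*, Proc. R.
  Soc. Lond. A 459 (2003) 2011–2032, arXiv:quant-ph/0201143: §3, proof of lemma `ratpbl`
  ((b) block states; Cases 1 and 2; "using only rational arithmetic operations").
-/

noncomputable section

namespace Literature.Barriers.QuantumAdvantage

open Finset Matrix Literature.Computability.Cryptography Literature.Computability.QuantumComplexity

variable {N : ℕ}

/-! ### Scalar multiples -/

section Smul

variable {ψ : QReg N → ℂ} {S : Finset (Fin N)}

/-- Splitting is invariant under scalars. [folklore] -/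
theorem Splits.smul (h : Splits ψ S) (s : ℂ) : Splits (s • ψ) S := by
  obtain ⟨e, f, he, hf, hψ⟩ := h
  refine ⟨fun x => s * e x, f, fun x y hxy => ?_, hf, fun x => ?_⟩
  · change s * e x = s * e y
    rw [he hxy]
  · rw [Pi.smul_apply, smul_eq_mul, hψ x, mul_assoc]

/-- Splitting is invariant under nonzero scalars. [folklore] -/
theorem splits_smul_iff {s : ℂ} (hs : s ≠ 0) : Splits (s • ψ) S ↔ Splits ψ S :=
  ⟨fun h => by
    have h' := h.smul s⁻¹
    rwa [smul_smul, inv_mul_cancel₀ hs, one_smul] at h', fun h => h.smul s⟩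

/-- Atoms are invariant under nonzero scalars. [folklore] -/
theorem atom_smul {s : ℂ} (hs : s ≠ 0) (i : Fin N) : atom (s • ψ) i = atom ψ i := by
  ext j
  simp only [mem_atom, splits_smul_iff hs]

/-- Gram data scale by the squared modulus. [folklore] -/
theorem gram_smul (B : Finset (Fin N)) (s : ℂ) (w : QReg N → ℂ) (x y : QReg N) :
    gram B (s • w) x y = s * starRingEnd ℂ s * gram B w x y := by
  unfold gram
  rw [Finset.mul_sum]
  refine sum_congr rfl fun r _ => ?_
  simp only [Pi.smul_apply, smul_eq_mul, map_mul]
  ring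

/-- `√2^n ≠ 0` in `ℂ`. [folklore] -/
theorem sqrt_two_pow_ne_zero (n : ℕ) : ((Real.sqrt 2 : ℂ) ^ n) ≠ 0 :=
  pow_ne_zero n (Complex.ofReal_ne_zero.2 (Real.sqrt_ne_zero'.2 two_pos))

/-- `√2^n · conj (√2^n) = 2^n` in `ℂ`. [folklore] -/
theorem sqrt_two_pow_mul_conj (n : ℕ) :
    (Real.sqrt 2 : ℂ) ^ n * starRingEnd ℂ ((Real.sqrt 2 : ℂ) ^ n) = (2 : ℂ) ^ n := by
  rw [map_pow, ← mul_pow, sqrt_two_mul_conj_sqrt_two]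

end Smul

/-! ### Partial trace in coordinates (any coordinate vector) -/

/-- **Partial trace, integrally**: for `A ⊆ C`, `gramZ A c = ∑_{t ∈ cfg (C ∖ A)} gramZ C c (t ∪ ·) (t ∪ ·)`.
[cite: JozsaLinden2003, §3 (proof of lemma ratpbl, Case 2: reduced states of subsets)] -/
theorem gramZ_eq_sum_gramZ {A C : Finset (Fin N)} (hAC : A ⊆ C) (c : QReg N → ZW) (u v : QReg N) :
    gramZ A c u v = ∑ t ∈ cfg (C \ A), gramZ C c ((C \ A).piecewise t u) ((C \ A).piecewise t v) := by
  apply ZW.zwVal_injective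
  rw [zwVal_gramZ, ZW.zwVal_sum, gram_eq_sum_gram hAC]
  exact sum_congr rfl fun t _ => (zwVal_gramZ _ _ _ _).symm

/-! ### The data of a Clifford+`T` family -/

section Family

variable (F : QCircuitFamily cliffordT) (x : List Bool)

/-- The rescaled integral state has the splitting sets of the state. [folklore] -/
theorem splits_ampZ_iff (hF : F.IsOracleFree) {j : ℕ} {S : Finset (Fin (x.length + F.ancillas x.length))} :
    Splits (fun y => ZW.zwVal (F.ampZ x j y)) S ↔ Splits (F.stateAfter x j) S := by
  rw [zwVal_comp_ampZ F x hF j, splits_smul_iff (sqrt_two_pow_ne_zero _)]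

/-- The rescaled integral state has the atoms of the state. [folklore] -/
theorem atom_ampZ (hF : F.IsOracleFree) (j : ℕ) (i : Fin (x.length + F.ancillas x.length)) :
    atom (fun y => ZW.zwVal (F.ampZ x j y)) i = atom (F.stateAfter x j) i := by
  rw [zwVal_comp_ampZ F x hF j, atom_smul (sqrt_two_pow_ne_zero _)]

/-- The rescaled integral state is not the zero vector. [folklore] -/
theorem zwVal_ampZ_ne_zero (hF : F.IsOracleFree) (j : ℕ) : (fun y => ZW.zwVal (F.ampZ x j y)) ≠ 0 := by
  intro h
  have h2 := cnormSq_ampZ F hF x j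
  rw [h] at h2
  have h3 : (2 : ℂ) ^ F.hExp x j = 0 := by simpa [cnormSq] using h2.symm
  exact pow_ne_zero _ two_ne_zero h3

/-- **Merge, integrally**: for a splitting `B₁` and a disjoint `B₂`,
`gramZ (B₁ ∪ B₂) = divPow h (gramZ B₁ ⋆ gramZ B₂)` on the integral amplitudes after `j` gates
(`h` = Hadamard count): the data of the union of two blocks, exactly.
[cite: JozsaLinden2003, §3 (proof of lemma ratpbl, Case 2: "amalgamating the two block labels")] -/
theorem gramZ_union_ampZ (hF : F.IsOracleFree) (j : ℕ) {B₁ B₂ : Finset (Fin (x.length + F.ancillas x.length))}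
    (h₁ : Splits (F.stateAfter x j) B₁) (h₁₂ : Disjoint B₁ B₂) (u v : QReg (x.length + F.ancillas x.length)) :
    gramZ (B₁ ∪ B₂) (F.ampZ x j) u v =
      ZW.divPow (F.hExp x j) (ZW.mul (gramZ B₁ (F.ampZ x j) u v) (gramZ B₂ (F.ampZ x j) u v)) := by
  symm
  apply ZW.divPow_eq_of_zwVal_eq
  rw [ZW.zwVal_mul, zwVal_gramZ, zwVal_gramZ, zwVal_gramZ,
    gram_mul_gram ((splits_ampZ_iff F x hF).2 h₁) h₁₂, cnormSq_ampZ F hF x j, mul_comm]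

/-- **Gate inside, integrally**: if gate `j` is `op` placed on wires `e` inside `C`, then
`gramZ C (ampZ (j+1)) u v = ∑_{z, z'} gateZ op (u|_e, z) · gramZ C (ampZ j) (u[e↦z]) (v[e↦z']) · cconj (gateZ op (v|_e, z'))`.
[cite: JozsaLinden2003, §3 (proof of lemma ratpbl, Cases 1 and 2: "applying a unitary matrix of size at most 2^{2p} × 2^{2p}")] -/
theorem gramZ_ampZ_succ_of_subset {j : ℕ} (hj : j < (F.circ x.length).gates.length)
    {op : CliffordTOp} {e : Fin (cliffordT.arity op) ↪ Fin (x.length + F.ancillas x.length)}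
    (hg : (F.circ x.length).gates[j] = QGate.gate op e) {C : Finset (Fin (x.length + F.ancillas x.length))}
    (hC : ∀ k, e k ∈ C) (u v : QReg (x.length + F.ancillas x.length)) :
    gramZ C (F.ampZ x (j + 1)) u v =
      ∑ z : QReg (cliffordT.arity op), ∑ z' : QReg (cliffordT.arity op),
        ZW.mul (ZW.mul (gateZ op (u ∘ e) z)
          (gramZ C (F.ampZ x j) (Function.extend e z u) (Function.extend e z' v)))
          (ZW.cconj (gateZ op (v ∘ e) z')) := by
  apply ZW.zwVal_injective
  have hgate : (QGate.gate op e : QGate cliffordT _).IsOracleFree := trivial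
  have hvec : (fun y => ZW.zwVal (F.ampZ x (j + 1) y)) =
      ((Real.sqrt 2 : ℂ) ^ sqrtTwoExp op) •
        (placeGate e (cliffordT.mat op) *ᵥ fun y => ZW.zwVal (F.ampZ x j y)) := by
    funext y
    rw [ampZ_succ F x hj, hg, zwVal_applyZ hgate (fun _ => rfl), Pi.smul_apply, smul_eq_mul]
    rfl
  rw [zwVal_gramZ, hvec, gram_smul, gram_placeGate_mulVec_of_subset e hC, ZW.zwVal_sum,
    Finset.mul_sum]
  refine sum_congr rfl fun z _ => ?_
  rw [ZW.zwVal_sum, Finset.mul_sum]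
  refine sum_congr rfl fun z' _ => ?_
  rw [ZW.zwVal_mul, ZW.zwVal_mul, ZW.zwVal_cconj, zwVal_gateZ, zwVal_gateZ, zwVal_gramZ, map_mul,
    map_pow, Complex.conj_ofReal]
  ring

/-- **Gate outside, integrally**: if gate `j` is placed on wires avoiding `B`, then
`gramZ B (ampZ (j+1)) = 2^{qScale} • gramZ B (ampZ j)` (the reduced state of `B` is unchanged;
the factor accounts for the rescaling of a Hadamard gate).
[cite: JozsaLinden2003, §3 (proof of lemma ratpbl, Cases 1 and 2: the other blocks are untouched)] -/
theorem gramZ_ampZ_succ_of_disjoint {j : ℕ} (hj : j < (F.circ x.length).gates.length)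
    {op : CliffordTOp} {e : Fin (cliffordT.arity op) ↪ Fin (x.length + F.ancillas x.length)}
    (hg : (F.circ x.length).gates[j] = QGate.gate op e) {B : Finset (Fin (x.length + F.ancillas x.length))}
    (hB : ∀ k, e k ∉ B) (u v : QReg (x.length + F.ancillas x.length)) :
    gramZ B (F.ampZ x (j + 1)) u v = (2 : ℤ) ^ sqrtTwoExp op • gramZ B (F.ampZ x j) u v := by
  apply ZW.zwVal_injective
  have hgate : (QGate.gate op e : QGate cliffordT _).IsOracleFree := trivial
  have hvec : (fun y => ZW.zwVal (F.ampZ x (j + 1) y)) =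
      ((Real.sqrt 2 : ℂ) ^ sqrtTwoExp op) •
        (placeGate e (cliffordT.mat op) *ᵥ fun y => ZW.zwVal (F.ampZ x j y)) := by
    funext y
    rw [ampZ_succ F x hj, hg, zwVal_applyZ hgate (fun _ => rfl), Pi.smul_apply, smul_eq_mul]
    rfl
  rw [zwVal_gramZ, hvec, gram_smul, gram_placeGate_mulVec_of_disjoint e hB (cliffordT_isUnitary_holds op),
    sqrt_two_pow_mul_conj, ZW.zwVal_zsmul, zwVal_gramZ]
  push_cast
  ring

/-- A nonzero diagonal Gram entry exists on every wire set (the rescaled state being nonzero).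
[folklore] -/
theorem exists_gramZ_self_ne_zero (hF : F.IsOracleFree) (j : ℕ) (C : Finset (Fin (x.length + F.ancillas x.length))) :
    ∃ y ∈ cfg C, gramZ C (F.ampZ x j) y y ≠ 0 := by
  obtain ⟨y, hy, hne⟩ := exists_gram_self_ne_zero C (zwVal_ampZ_ne_zero F x hF j)
  refine ⟨y, hy, fun h => hne ?_⟩
  rw [← zwVal_gramZ, h, ZW.zwVal_zero]

/-- **The split test, integrally.** If `C` splits the state after `j` gates and
`gramZ C (ampZ j) y₀ y₀ ≠ 0`, then for `S ⊆ C` the state splits across `S` iff, with the column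
`u ↦ gramZ C (ampZ j) u y₀`, all products `col u · col v` and `col (u|_S, v) · col (v|_S, u)` agree
coordinatewise. [cite: JozsaLinden2003, §3 (proof of lemma ratpbl, Case 2: "looking for an equality of states")] -/
theorem splits_stateAfter_iff_columnZ (hF : F.IsOracleFree) {j : ℕ}
    {C : Finset (Fin (x.length + F.ancillas x.length))} (hC : Splits (F.stateAfter x j) C)
    {y₀ : QReg (x.length + F.ancillas x.length)} (hy₀ : gramZ C (F.ampZ x j) y₀ y₀ ≠ 0)
    {S : Finset (Fin (x.length + F.ancillas x.length))} (hS : S ⊆ C) :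
    Splits (F.stateAfter x j) S ↔
      ∀ u v : QReg (x.length + F.ancillas x.length),
        ZW.mul (gramZ C (F.ampZ x j) u y₀) (gramZ C (F.ampZ x j) v y₀) =
          ZW.mul (gramZ C (F.ampZ x j) (S.piecewise u v) y₀) (gramZ C (F.ampZ x j) (S.piecewise v u) y₀) := by
  have hy₀' : gram C (fun y => ZW.zwVal (F.ampZ x j y)) y₀ y₀ ≠ 0 := by
    rwa [← zwVal_gramZ, Ne, ZW.zwVal_eq_zero_iff]
  rw [← splits_ampZ_iff F x hF, splits_iff_column_mul_eq ((splits_ampZ_iff F x hF).2 hC) hy₀' hS]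
  refine forall_congr' fun u => forall_congr' fun v => ?_
  rw [← ZW.zwVal_inj, ZW.zwVal_mul, ZW.zwVal_mul, zwVal_gramZ, zwVal_gramZ, zwVal_gramZ, zwVal_gramZ]

/-- The column entries only see the `C`-part of their row index, so the split test may be run
over the configurations of `C` only. [folklore] -/
theorem columnZ_test_iff_cfg {c : QReg N → ZW} {C S : Finset (Fin N)} (hS : S ⊆ C) {y₀ : QReg N} :
    (∀ u v : QReg N, ZW.mul (gramZ C c u y₀) (gramZ C c v y₀) =
        ZW.mul (gramZ C c (S.piecewise u v) y₀) (gramZ C c (S.piecewise v u) y₀)) ↔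
      ∀ u ∈ cfg C, ∀ v ∈ cfg C, ZW.mul (gramZ C c u y₀) (gramZ C c v y₀) =
        ZW.mul (gramZ C c (S.piecewise u v) y₀) (gramZ C c (S.piecewise v u) y₀) := by
  constructor
  · exact fun h u _ v _ => h u v
  · intro h u v
    have hu : ∀ w : QReg N, gramZ C c w y₀ = gramZ C c (proj C w) y₀ := fun w =>
      gramZ_congr (fun i hi => (proj_apply_of_mem w hi).symm) (fun _ _ => rfl)
    have hpw : ∀ w w' : QReg N, proj C (S.piecewise w w') = S.piecewise (proj C w) (proj C w') := by
      intro w w'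
      funext i
      by_cases hiS : i ∈ S
      · rw [piecewise_eq_of_mem _ _ _ hiS, proj_apply_of_mem _ (hS hiS), proj_apply_of_mem _ (hS hiS),
          piecewise_eq_of_mem _ _ _ hiS]
      · rw [piecewise_eq_of_notMem _ _ _ hiS]
        by_cases hiC : i ∈ C
        · rw [proj_apply_of_mem _ hiC, proj_apply_of_mem _ hiC, piecewise_eq_of_notMem _ _ _ hiS]
        · rw [proj_apply_of_notMem _ hiC, proj_apply_of_notMem _ hiC]
    rw [hu u, hu v, hu (S.piecewise u v), hu (S.piecewise v u), hpw, hpw]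
    exact h _ (proj_mem_cfg _ _) _ (proj_mem_cfg _ _)

/-- **The new blocks inside `C` are cut out by the split tests**: at gate `j`, for `i` in the
union `C` of the touched blocks, `k ∈ atom (state after j+1) i` iff `k` lies in every `S ⊆ C` that
splits the new state and contains `i`. [cite: JozsaLinden2003, §3 (proof of lemma ratpbl, Case 2: "identify a new block structure … within the qubits of B₁ and B₂")] -/
theorem mem_atom_stateAfter_succ_iff (hF : F.IsOracleFree) {j : ℕ} (hj : j < (F.circ x.length).gates.length)
    {i k : Fin (x.length + F.ancillas x.length)}
    (hi : i ∈ touchUnion (blocksAfter F x j) ((F.circ x.length).gates[j]).wires) :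
    k ∈ atom (F.stateAfter x (j + 1)) i ↔
      ∀ S ⊆ touchUnion (blocksAfter F x j) ((F.circ x.length).gates[j]).wires,
        Splits (F.stateAfter x (j + 1)) S → i ∈ S → k ∈ S :=
  mem_atom_iff_of_splits (splits_touchUnion_succ hF hj) hi

end Family

end Literature.Barriers.QuantumAdvantage

end
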